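import Mathlib
import Summits.RiemannHypothesis.RiemannHypothesis.Theorems.WeilParityOffLineParityDetectionStubEvenOffLineCauchySchwarz
import Summits.RiemannHypothesis.RiemannHypothesis.Theorems.WeilParityOffLineParityDetectionTorusGramIntegrals
import Summits.RiemannHypothesis.RiemannHypothesis.Theorems.WeilParityOffLineParityDetectionTorusGramForms
import Summits.RiemannHypothesis.RiemannHypothesis.Theorems.WeilParityOffLineParityDetectionTorusGramCutoff
import Summits.RiemannHypothesis.RiemannHypothesis.Theorems.WeilParityOffLineParityDetectionTorusGramAssembly
import Summits.RiemannHypothesis.RiemannHypothesis.Theorems.WeilParityOffLineParityDetectionStubTorusTopHeavySeparated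
import HarnessLib

/-!
# Crux `OffLineParityDetection`, line `registered`: stub RESIDUAL-ONE (top-heaviness of the
# mirror-pairing form for a top layer with a single absolute ordinate)

Route `WeilParity`, crux
`Summit.RiemannHypothesis.RiemannHypothesis.Theses.WeilParity.OffLineParityDetection`
(item stmt-RiemannHypothesis-15431), line `registered`.  This file proves the registered stub
`stub_residualOneOrdinate` BY NAME, with the registered signature (`ζ`-free real analysis).

Setting: `η₀ > 0`, a finite nonempty top layer `T ⊂ {Re ρ = 1/2 + η₀}` with positive weights `w`,
the Laplace integrals `F_f(ρ) = ∫₀^∞ f e^{-(ρ-1/2)u} du` of smooth compactly supported real profiles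
on `[0, ∞)` and the mirror-pairing form `gain(a, f) = Σ_T w Re(e^{2i(Im ρ)a} F_f(ρ)²)`.
Hypothesis: all `ρ ∈ T` share ONE absolute ordinate `g = |Im ρ|`.  Conclusion (top-heaviness): at
some phase point `a` there are `D ≥ 0`, `δ > 0` with `-gain(a, f) ≤ D‖f‖²` for every profile and
`gain(a, f₀) ≥ (D + δ)‖f₀‖²` for one profile `f₀ ≠ 0`.

## Proof (the `J = 1` law, RESIDUAL-analysis §0; all pieces in the imported helper files)

* `g = 0`: the elementary degenerate case `torusSep_degenerate` (`a = 0`, `D = 0`).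
* `g > 0`: by the NORMAL FORM (`torusSep_gain_classes`) `gain(a, f) = M (⟨f,c⟩² - ⟨f,s⟩²)` with
  the class weight `M = Σ_T w > 0`, `c(u) = e^{-η₀u} cos(g(u-a))`, `s(u) = e^{-η₀u} sin(g(u-a))`.
  DANGER: `-gain ≤ M⟨f,s⟩² ≤ M‖s‖²‖f‖²` (Cauchy–Schwarz), `D := M‖s‖²`,
  `‖s‖² = (h(0) - h(2g))/2`, `h` the closed form of `∫₀^∞ e^{-2η₀u} cos(ω(u-a)) du`
  (`…TorusGramIntegrals`).  GAIN of the ideal profile `c` at the optimal phase `2ga = arctan(g/η₀)`: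
  there the cross Gram entry `⟨c,s⟩ = q(2g)/2` VANISHES and `h(2g) > 0`, so
  `gain(a,c) = M‖c‖⁴`, `‖c‖² = (h(0) + h(2g))/2 > ‖s‖²`, i.e. `D‖c‖² < gain(a, c)` strictly; the
  strict inequality passes to a smooth compactly supported cut-off `f₀` of `c`
  (`torusSep_cutoff_select`, dominated convergence), `δ := (gain(a,f₀) - D‖f₀‖²)/‖f₀‖²`.
-/

set_option linter.dupNamespace false

noncomputable section

namespace Summit.RiemannHypothesis.RiemannHypothesis.Theorems.WeilParityOffLineParityDetection

open MeasureTheory Set Filter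
open scoped ComplexConjugate
open Literature.NumberTheory.LFunctions

/-- Stub **RESIDUAL-ONE** of crux `OffLineParityDetection` (line `registered`), `ζ`-free: a top
layer with a single absolute ordinate `g` is top-heavy — the `J = 1` law of the class-summed weight
`M` (for `g = 0` the form is a PSD rank-one form and `a = 0` works; for `g > 0` the danger bound is
`D = M‖s‖²` and the gaining profile is a cut-off of `e^{-η₀u} cos(g(u - a))` at the phase
`2ga = arctan(g/η₀)`, where the cross Gram entry vanishes); see the module docstring. [folklore] -/
theorem stub_residualOneOrdinate :
    ∀ η₀ : ℝ, 0 < η₀ → ∀ T : Finset ℂ, T.Nonempty → (∀ ρ ∈ T, ρ.re = 1 / 2 + η₀) →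
      ∀ w : ℂ → ℝ, (∀ ρ ∈ T, 0 < w ρ) →
      (T.image (fun ρ : ℂ ↦ |ρ.im|)).card = 1 →
      ∃ δ : ℝ, 0 < δ ∧ ∃ a : ℝ, ∃ D : ℝ, 0 ≤ D ∧
        (∀ f : ℝ → ℝ, ContDiff ℝ (⊤ : ℕ∞) f → HasCompactSupport f → tsupport f ⊆ Set.Ici 0 →
          -(∑ ρ ∈ T, w ρ * (Complex.exp (2 * (ρ.im : ℂ) * (a : ℂ) * Complex.I) *
              (∫ u in Set.Ioi (0 : ℝ), (f u : ℂ) * Complex.exp (-((ρ - 1 / 2) * (u : ℂ)))) ^ 2).re)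
            ≤ D * ∫ u in Set.Ioi (0 : ℝ), f u ^ 2) ∧
        (∃ f : ℝ → ℝ, ContDiff ℝ (⊤ : ℕ∞) f ∧ HasCompactSupport f ∧ tsupport f ⊆ Set.Ici 0 ∧
          0 < ∫ u in Set.Ioi (0 : ℝ), f u ^ 2 ∧
          (D + δ) * ∫ u in Set.Ioi (0 : ℝ), f u ^ 2 ≤
            ∑ ρ ∈ T, w ρ * (Complex.exp (2 * (ρ.im : ℂ) * (a : ℂ) * Complex.I) *
              (∫ u in Set.Ioi (0 : ℝ), (f u : ℂ) * Complex.exp (-((ρ - 1 / 2) * (u : ℂ)))) ^ 2).re) := by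
  intro η hη T hTne hTre w hw hcard
  obtain ⟨g, hG⟩ := Finset.card_eq_one.1 hcard
  have habs : ∀ ρ ∈ T, |ρ.im| = g := fun ρ hρ ↦ by
    have h := Finset.mem_image_of_mem (fun ρ : ℂ ↦ |ρ.im|) hρ
    rw [hG, Finset.mem_singleton] at h
    exact h
  obtain ⟨ρ₀, hρ₀⟩ := id hTne
  have hg0 : 0 ≤ g := by
    rw [← habs ρ₀ hρ₀]
    exact abs_nonneg _
  rcases hg0.eq_or_lt with hgz | hgpos
  · -- all ordinates vanish: the elementary degenerate case
    have him : ∀ ρ ∈ T, ρ.im = 0 := fun ρ hρ ↦ abs_eq_zero.1 ((habs ρ hρ).trans hgz.symm)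
    exact torusSep_degenerate η hη T hTne hTre w hw him
  /- ### one positive absolute ordinate `g`: the phase point `2 g a = arctan (g / η)` -/
  have hgne : g ≠ 0 := hgpos.ne'
  set θ : ℝ := Real.arctan (g / η) with hθ
  set a : ℝ := θ / (2 * g) with ha
  have h2ga : 2 * g * a = θ := by
    rw [ha]
    field_simp
  have hcosθ : Real.cos θ = 1 / Real.sqrt (1 + (g / η) ^ 2) := Real.cos_arctan _
  have hsinθ : Real.sin θ = g / η / Real.sqrt (1 + (g / η) ^ 2) := Real.sin_arctan _
  have hcθ : 0 < Real.cos θ := Real.cos_arctan_pos _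
  have hsθ : 0 ≤ Real.sin θ := by
    rw [hsinθ]
    positivity
  -- the closed forms of the half-line integrals
  set Hf : ℝ → ℝ := fun ω ↦
    (2 * η * Real.cos (ω * a) + ω * Real.sin (ω * a)) / (4 * η ^ 2 + ω ^ 2) with hHf
  set Qf : ℝ → ℝ := fun ω ↦
    (ω * Real.cos (ω * a) - 2 * η * Real.sin (ω * a)) / (4 * η ^ 2 + ω ^ 2) with hQf
  have hH : ∀ ω, Hf ω = (2 * η * Real.cos (ω * a) + ω * Real.sin (ω * a)) / (4 * η ^ 2 + ω ^ 2) :=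
    fun ω ↦ rfl
  have hQ : ∀ ω, Qf ω = (ω * Real.cos (ω * a) - 2 * η * Real.sin (ω * a)) / (4 * η ^ 2 + ω ^ 2) :=
    fun ω ↦ rfl
  have hH0 : Hf 0 = 1 / (2 * η) := by
    rw [hH]
    simp only [zero_mul, Real.cos_zero, Real.sin_zero, mul_one, mul_zero, add_zero, ne_eq,
      OfNat.ofNat_ne_zero, not_false_eq_true, zero_pow]
    field_simp
    ring
  have hQ0 : Qf 0 = 0 := by
    rw [hQ]
    simp
  have hH2 : 0 < Hf (2 * g) := by
    rw [hH, h2ga]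
    apply div_pos _ (by positivity)
    nlinarith [mul_pos hη hcθ, mul_nonneg hgpos.le hsθ]
  have hQ2 : Qf (2 * g) = 0 := by
    rw [hQ, h2ga, hcosθ, hsinθ, div_eq_zero_iff]
    left
    field_simp
    ring
  have hNcc0 : 0 < (Hf 0 + Hf (2 * g)) / 2 := by
    have h1 : 0 < Hf 0 := by
      rw [hH0]
      positivity
    linarith
  /- ### the class weight and the normal form of the gain -/
  set M : ℝ := ∑ ρ ∈ T.filter (fun ρ : ℂ ↦ |ρ.im| = g), w ρ with hM
  have hM0 : 0 < M :=
    Finset.sum_pos (fun σ hσ ↦ hw σ (Finset.mem_filter.1 hσ).1)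
      ⟨ρ₀, Finset.mem_filter.2 ⟨hρ₀, habs ρ₀ hρ₀⟩⟩
  have hgainG : ∀ f : ℝ → ℝ, Continuous f → HasCompactSupport f →
      ∑ ρ ∈ T, w ρ * (Complex.exp (2 * (ρ.im : ℂ) * (a : ℂ) * Complex.I) *
        (∫ u in Set.Ioi (0 : ℝ), (f u : ℂ) * Complex.exp (-((ρ - 1 / 2) * (u : ℂ)))) ^ 2).re =
      M * ((∫ u in Ioi (0 : ℝ), f u * (Real.exp (-(η * u)) * Real.cos (g * (u - a)))) ^ 2
        - (∫ u in Ioi (0 : ℝ), f u * (Real.exp (-(η * u)) * Real.sin (g * (u - a)))) ^ 2) := by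
    intro f hf hfs
    rw [torusSep_gain_classes T hTre w a hf hfs, hG, Finset.sum_singleton]
  /- ### the sine profile: its energy and the danger bound -/
  have hss_int : IntegrableOn (fun u ↦ Real.exp (-(η * u)) * Real.sin (g * (u - a)) *
      (Real.exp (-(η * u)) * Real.sin (g * (u - a)))) (Ioi 0) :=
    torusSep_integrableOn_prod hη (by fun_prop) (by fun_prop) (fun u ↦ Real.abs_sin_le_one _)
      (fun u ↦ Real.abs_sin_le_one _)
  have hNss : ∫ u in Ioi (0 : ℝ), (Real.exp (-(η * u)) * Real.sin (g * (u - a))) ^ 2 =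
      (Hf 0 - Hf (2 * g)) / 2 := by
    have h := torusSep_gram_ss hη a g g hH
    rw [sub_self, ← two_mul] at h
    rw [← h]
    exact integral_congr_ae (ae_of_all _ fun u ↦ sq _)
  have hNss0 : 0 ≤ (Hf 0 - Hf (2 * g)) / 2 := by
    rw [← hNss]
    exact integral_nonneg fun u ↦ sq_nonneg _
  set D : ℝ := M * ((Hf 0 - Hf (2 * g)) / 2) with hD
  have hD0 : 0 ≤ D := mul_nonneg hM0.le hNss0
  have hdanger : ∀ f : ℝ → ℝ, ContDiff ℝ (⊤ : ℕ∞) f → HasCompactSupport f →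
      tsupport f ⊆ Set.Ici 0 →
      -(∑ ρ ∈ T, w ρ * (Complex.exp (2 * (ρ.im : ℂ) * (a : ℂ) * Complex.I) *
        (∫ u in Set.Ioi (0 : ℝ), (f u : ℂ) * Complex.exp (-((ρ - 1 / 2) * (u : ℂ)))) ^ 2).re) ≤
      D * ∫ u in Set.Ioi (0 : ℝ), f u ^ 2 := by
    intro f hf hfs _
    rw [hgainG f hf.continuous hfs]
    have hfc := hf.continuous
    have hf2 : Integrable (fun u ↦ f u ^ 2) (volume.restrict (Ioi (0 : ℝ))) :=
      (((hfc.mul hfc).integrable_of_hasCompactSupport hfs.mul_right).integrableOn (s := Ioi 0)).congr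
        (ae_of_all _ fun u ↦ (sq (f u)).symm)
    have hs2 : Integrable (fun u ↦ (Real.exp (-(η * u)) * Real.sin (g * (u - a))) ^ 2)
        (volume.restrict (Ioi (0 : ℝ))) :=
      hss_int.congr (ae_of_all _ fun u ↦ (sq _).symm)
    have hfsI : Integrable (fun u ↦ f u * (Real.exp (-(η * u)) * Real.sin (g * (u - a))))
        (volume.restrict (Ioi (0 : ℝ))) :=
      ((hfc.mul (by fun_prop)).integrable_of_hasCompactSupport hfs.mul_right).integrableOn
    have hCS := sq_integral_mul_le hf2 hs2 hfsI
    rw [hNss] at hCS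
    have hc2 : 0 ≤ M *
        (∫ u in Ioi (0 : ℝ), f u * (Real.exp (-(η * u)) * Real.cos (g * (u - a)))) ^ 2 :=
      mul_nonneg hM0.le (sq_nonneg _)
    have h1 : M * (∫ u in Ioi (0 : ℝ), f u * (Real.exp (-(η * u)) * Real.sin (g * (u - a)))) ^ 2 ≤
        M * ((∫ u in Ioi (0 : ℝ), f u ^ 2) * ((Hf 0 - Hf (2 * g)) / 2)) :=
      mul_le_mul_of_nonneg_left hCS hM0.le
    rw [hD]
    linarith
  /- ### the ideal profile `c` and the strict inequality at the optimal phase -/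
  set p : ℝ → ℝ := fun u ↦ Real.exp (-(η * u)) * Real.cos (g * (u - a)) with hpdef
  obtain ⟨hp1, hp2, hp3, hp4, hp5⟩ :=
    torusSep_profile (ι := Unit) hη a (fun _ ↦ g) (fun _ ↦ (1 : ℝ)) hH hQ (p := p)
      (fun u ↦ by simp [hpdef])
  have hp3' : ∫ u in Ioi (0 : ℝ), p u ^ 2 = (Hf 0 + Hf (2 * g)) / 2 := by
    rw [hp3]
    simp only [Finset.sum_const, Finset.card_univ, Fintype.card_unit, one_smul, one_mul, sub_self,
      ← two_mul]
  have hp4' : ∫ u in Ioi (0 : ℝ), p u * (Real.exp (-(η * u)) * Real.cos (g * (u - a))) =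
      (Hf 0 + Hf (2 * g)) / 2 := by
    rw [hp4 ()]
    simp only [Finset.sum_const, Finset.card_univ, Fintype.card_unit, one_smul, one_mul, sub_self,
      ← two_mul]
  have hp5' : ∫ u in Ioi (0 : ℝ), p u * (Real.exp (-(η * u)) * Real.sin (g * (u - a))) = 0 := by
    rw [hp5 (), sub_self, ← two_mul, hQ0, hQ2, add_zero, zero_div]
    simp
  have hstrict : D * ∫ u in Ioi (0 : ℝ), p u ^ 2 <
      ∑ _i : Unit, M * ((∫ u in Ioi (0 : ℝ), p u * (Real.exp (-(η * u)) * Real.cos (g * (u - a)))) ^ 2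
        - (∫ u in Ioi (0 : ℝ), p u * (Real.exp (-(η * u)) * Real.sin (g * (u - a)))) ^ 2) := by
    simp only [Finset.sum_const, Finset.card_univ, Fintype.card_unit, one_smul]
    rw [hp3', hp4', hp5', hD]
    nlinarith [mul_pos (mul_pos hM0 hH2) hNcc0]
  /- ### the gaining profile: a cut-off of `c` -/
  obtain ⟨f₀, hf₀1, hf₀2, hf₀3, hf₀pos, hf₀strict⟩ := torusSep_cutoff_select (ι := Unit) hη hp1
    (A := 1) (fun u _ ↦ by
      rw [one_mul]
      exact torusSep_abs_damped_le Real.cos Real.abs_cos_le_one u _)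
    (by rw [hp3']; exact hNcc0)
    (fun _ u ↦ Real.exp (-(η * u)) * Real.cos (g * (u - a)))
    (fun _ u ↦ Real.exp (-(η * u)) * Real.sin (g * (u - a)))
    (fun _ ↦ by fun_prop) (fun _ ↦ by fun_prop)
    (fun _ u _ ↦ torusSep_abs_damped_le Real.cos Real.abs_cos_le_one u _)
    (fun _ u _ ↦ torusSep_abs_damped_le Real.sin Real.abs_sin_le_one u _) (fun _ ↦ M) D hstrict
  simp only [Finset.sum_const, Finset.card_univ, Fintype.card_unit, one_smul] at hf₀strict
  /- ### the conclusion -/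
  set Γ : ℝ := M * ((∫ u in Ioi (0 : ℝ), f₀ u * (Real.exp (-(η * u)) * Real.cos (g * (u - a)))) ^ 2 -
      (∫ u in Ioi (0 : ℝ), f₀ u * (Real.exp (-(η * u)) * Real.sin (g * (u - a)))) ^ 2) with hΓ
  set E : ℝ := ∫ u in Ioi (0 : ℝ), f₀ u ^ 2 with hE
  refine ⟨(Γ - D * E) / E, div_pos (by linarith) hf₀pos, a, D, hD0, hdanger, f₀, hf₀1, hf₀2,
    hf₀3, hf₀pos, ?_⟩
  rw [hgainG f₀ hf₀1.continuous hf₀2, ← hΓ, ← hE]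
  apply le_of_eq
  field_simp
  ring

end Summit.RiemannHypothesis.RiemannHypothesis.Theorems.WeilParityOffLineParityDetection

end
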